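import Literature.Barriers.MatrixMultiplication.RectangularBarrier
import Literature.Computability.AlgebraicComplexity.AsymptoticSpectrumDuality
import Literature.Computability.AlgebraicComplexity.AsymptoticRankMatMul
import Literature.Computability.AlgebraicComplexity.MatMulMonomialSubrankAsymptotics
import Literature.Computability.AlgebraicComplexity.RelativeExponent
import Literature.Computability.AlgebraicComplexity.DegenerationSpectralMonotone
import Literature.Computability.AlgebraicComplexity.FlatteningRank
import Literature.Computability.AlgebraicComplexity.AsymptoticSpectrumProofs
import HarnessLib

/-!
# The spectrum of matrix multiplication `(θ₁, θ₂, θ₃)` and Alman–Li's "complicated example"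
# (Alman–Li 2026, Prop. 4.1, Def. 4.1, Prop. 4.2, Prop. 4.5) — proved

Topic `Literature/Computability/AlgebraicComplexity`; sibling of `AlmanLi2026ToyBound.lean` (Prop. 4.4,
Cor. 4.1).  J. Alman, B. Li, *Asymptotic Rank Speedup Theorems, Revisited*, arXiv:2605.21738 (2026)
[AlmanLi2026], §4.1 "Matrix multiplication" and §4.3 "Complicated example", read first-hand from the
held text `paper:arxiv-2605.21738` (chunks p0009–p0011).  Everything is PROVED; two definitions
(`specMMPoint`, `specMM` = the paper's Def. 4.1), no named fact.

## Source, verbatim (p0009 L56–L121, p0010 L138 – p0011 L100)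

> **Proposition 4.1** ([Str88AsymSpec]). For any `φ ∈ 𝒳`, there exist unique real numbers
> `θ₁, θ₂, θ₃` such that `φ(⟨n,m,p⟩) = n^{θ₁} m^{θ₂} p^{θ₃}` for any `n, m, p`.
> *Proof.* Let `θ₁ = log₂ φ(⟨2,1,1⟩)`. We will show that `φ(⟨n,1,1⟩) = n^{θ₁}` for all `n`. For any
> `k`, let `t = ⌊log₂(n^k)⌋`, thus `2^t ≤ n^k < 2^{t+1}` and we have the restrictions
> `⟨2^t,1,1⟩ ≤ ⟨n^k,1,1⟩ ≤ ⟨2^{t+1},1,1⟩`. Since `φ` is monotone … Since `⟨n^k,1,1⟩ = ⟨n,1,1⟩^{⊗k}`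
> and `φ` is multiplicative … `2^{-θ₁} n^{kθ₁} ≤ 2^{θ₁ t} ≤ φ(⟨n,1,1⟩)^k ≤ 2^{θ₁(t+1)} ≤ 2^{θ₁} n^{kθ₁}`.
> Taking `k`th roots and letting `k → ∞`, we conclude `φ(⟨n,1,1⟩) = n^{θ₁}`. Similarly … `θ₂, θ₃` …
> Finally, since `⟨n,m,p⟩ = ⟨n,1,1⟩ ⊗ ⟨1,m,1⟩ ⊗ ⟨1,1,p⟩` and `φ` is multiplicative, we have
> `φ(⟨n,m,p⟩) = n^{θ₁} m^{θ₂} p^{θ₃}`.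
> **Definition 4.1** ([Str88AsymSpec]). The (logarithmic) spectrum `specMM ⊂ ℝ³` of matrix
> multiplication are the points `(θ₁, θ₂, θ₃)` that satisfy (Prop. 4.1).
> **Proposition 4.2.** Every `θᵢ` lies in `[0, 1]`. The value `θ₁ + θ₂ + θ₃` over `specMM` attains
> minimum `2` and maximum `ω`.
> *Proof.* … `min θ₁ = 0` and `max θ₁ = 1` … The value `θ₁ + θ₂ + θ₃`, by definition, equals
> `log_n φ(⟨n,n,n⟩)`. Thus by (Strassen duality) `max (θ₁+θ₂+θ₃) = max_φ log_n φ(⟨n,n,n⟩) =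
> log_n R̃(⟨n,n,n⟩)` and … `R̃(⟨n,n,n⟩) = n^ω`. Similarly `min (θ₁+θ₂+θ₃) = log_n Q̃(⟨n,n,n⟩)`, and
> matrix multiplication has optimal asymptotic subrank `Q̃(⟨n,n,n⟩) = n²` [Str87RelBilin].
> **Proposition 4.5.** If tensor `T` satisfies the degeneration relations on three directions
> `T ⊕ ⟨t,1,1⟩ ⊴ ⟨r⟩ ⊕ ⟨s,1,1⟩`, `T ⊕ ⟨1,t,1⟩ ⊴ ⟨r⟩ ⊕ ⟨1,s,1⟩`, `T ⊕ ⟨1,1,t⟩ ⊴ ⟨r⟩ ⊕ ⟨1,1,s⟩`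
> for some `s, t ≥ 1`, then its asymptotic rank satisfies `R̃(T) ≤ r + s^{2/3} − t^{2/3}` if `t > s`,
> and `R̃(T) ≤ r + s^{ω/3} − t^{ω/3}` if `t ≤ s`.
> *Proof.* Fix an arbitrary spectral point `φ ∈ 𝒳`. Applying `φ` to the three degeneration relations
> yields `φ(T) ≤ r + s^{θᵢ} − t^{θᵢ}` … Taking the strongest bound … `φ(T) ≤ r + minᵢ τ(θᵢ)`
> (set `τ(x) = s^x − t^x`). Case 1: `t > s`. Then `τ` is decreasing on `ℝ_{≥0}`, so
> `minᵢ τ(θᵢ) = τ(maxᵢ θᵢ)`. Since `θ₁ + θ₂ + θ₃ ≥ 2` (Prop. 4.2), we have `maxᵢ θᵢ ≥ 2/3`, and thus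
> `φ(T) ≤ r + τ(2/3)`. Case 2: `t ≤ s`. Then `τ` is increasing …, `minᵢ θᵢ ≤ (θ₁+θ₂+θ₃)/3 ≤ ω/3`, and
> therefore `φ(T) ≤ r + τ(ω/3)`. Since the above inequality holds for every `φ ∈ 𝒳`, Strassen duality
> gives [the claim].
> **Remark 4.2.** … In the case `t > s` we used the nontrivial inequality `θ₁ + θ₂ + θ₃ ≥ 2`, which
> ultimately comes from the optimal asymptotic subrank bound `Q̃(⟨n,n,n⟩) = n²`.

LOCATORS (append 1, correcting the span in the heading above): Prop. 4.1 and its proof are p0009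
L48–L90, Def. 4.1 p0009 L92–L94, Prop. 4.2 and its proof p0009 L98–L121, Prop. 4.5 p0010 L80 – p0011
L20 with proof p0011 L22–L85.  Append 1 adds §C′ below: the per-coordinate extremes "`min θ₁ = 0` and
`max θ₁ = 1`, and similarly for `θ₂, θ₃`" of the printed proof of Prop. 4.2 (p0009 L103–L105), witnessed by
the gauge points `ζ⁽¹⁾, ζ⁽²⁾, ζ⁽³⁾` (`AlmanLi2026.prop42_coord_isLeast`, `AlmanLi2026.prop42_coord_isGreatest`).

## Rendering (tree vocabulary; cf. `AlmanLi2026ThreeByThree.lean`, `AlmanLi2026ToyBound.lean`)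

A point `φ ∈ 𝒳` of the asymptotic spectrum is the tree's `IsUniversalSpectralPoint K F`
(`F : SpectralMap K`; additive under `directSumTensor`, multiplicative under `kroneckerTensor`,
`F(⟨1⟩) = 1`, monotone under `TensorRestrictsTo`; monotone under degeneration `AlgDegeneratesTo` by the
tree's `IsUniversalSpectralPoint.mono_of_algDegeneratesTo`).  `⟨n,m,p⟩` (an `n × m` by `m × p` product)
is the tree's `matMulTensor K n m p` (Bläser's `⟨k,m,n⟩ = Σ e_{κν} ⊗ e_{κμ} ⊗ e_{μν}`; the paper writes
the same tensor as `Σ x_{ij} y_{jk} z_{ki}`, a cyclic relabelling of the three slots, immaterial for every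
statement below, which are about the FORMAT parameters `n, m, p` and symmetric sets of hypotheses);
`⟨r⟩ = unitTensor K r`, `⊕ = directSumTensor`, `⊗ = kroneckerTensor`, `R̃ = asymptoticRank`,
`ω = omega K`; `T ⊴ S` is `AlgDegeneratesTo S T`.

* `specMMPoint F : Fin 3 → ℝ` — `(θ₁, θ₂, θ₃)(φ) = (log₂ φ(⟨2,1,1⟩), log₂ φ(⟨1,2,1⟩), log₂ φ(⟨1,1,2⟩))`
  (the numbers of Prop. 4.1, first line of its proof); `specMM K : Set (Fin 3 → ℝ)` — Def. 4.1.

## What is proved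

* `log_le_logb_two_mul_log`, `eq_rpow_logb_two` — the real-analysis core of the proof of Prop. 4.1: a
  monotone multiplicative `g : ℕ → ℝ` with `g 1 = 1` is `g(a) = a^{log₂ g(2)}` (`a ≥ 1`).  The lower
  half `log₂ g(2) · log a ≤ log g(a)` is the tree's
  `Literature.Barriers.MatrixMultiplication.logb_two_mul_log_le_log` (CLLZ 2025, proof of Lemma 3.7);
  the upper half is proved here by the same comparison `aᶜ < 2^{t+1}`.
* **`AlmanLi2026.prop41`** — Prop. 4.1: `φ(⟨n,m,p⟩) = n^{θ₁} m^{θ₂} p^{θ₃}` for all `n, m, p ≥ 1`, with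
  `θ = specMMPoint F`; `AlmanLi2026.prop41_unique` / `AlmanLi2026.prop41_existsUnique` — uniqueness.
* **`AlmanLi2026.prop42_mem_Icc`**, **`prop42_two_le_sum`**, **`prop42_sum_le_omega`**,
  **`prop42_isLeast`**, **`prop42_isGreatest`** — Prop. 4.2: `θᵢ ∈ [0,1]`; over `specMM` the sum
  `θ₁ + θ₂ + θ₃` has least value `2` (lower bound from `Q(⟨n,n,n⟩) ≥ n^{2−o(1)}`, the tree's
  `exists_tensorMonRestrictsTo_matMulTensor_unitTensor` — Behrend / Ruzsa–Szemerédi, a restriction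
  `⟨n,n,n⟩ ≥ ⟨R⟩`, `R ≥ n^{2−ε}` — in place of the paper's pointer to `Q̃(⟨n,n,n⟩) = n²`
  [Str87RelBilin]; attained by the gauge point `ζ⁽¹⁾`, `ζ⁽¹⁾(⟨n,n,n⟩) = n²`) and greatest value `ω`
  (`φ(⟨2,2,2⟩) ≤ R̃(⟨2,2,2⟩) = 2^ω`, attained by Strassen duality `strassen_duality_asymptoticRank_holds`).
* **`AlmanLi2026.prop45_of_le`**, **`AlmanLi2026.prop45_of_lt`**, **`AlmanLi2026.prop45`** — Prop. 4.5,
  following the printed proof line by line (the three spectral inequalities; `τ` monotone;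
  `max θᵢ ≥ 2/3`, resp. `min θᵢ ≤ ω/3`; Strassen duality, PROVED in the tree).

## Mathlib / tree search

Consumed by name: `IsUniversalSpectralPoint` + `.isAdequate` (CLLZ footnote 3, giving `mamu`,
`map_matMul_eq_mul₃`, `map_matMul_mono`, `map_matMul_one`), `.map_unitTensor`, `logb_two_mul_log_le_log`,
`tensorRestrictsTo_matMulTensor_of_le` (`Literature/Barriers/MatrixMultiplication/RectangularBarrier.lean`);
`strassen_duality_asymptoticRank_holds` (`AsymptoticSpectrumDuality`); `asymptoticRank_matMulTensor`
(`AsymptoticRankMatMul`); `exists_tensorMonRestrictsTo_matMulTensor_unitTensor`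
(`MatMulMonomialSubrankAsymptotics`), `TensorMonRestrictsTo.tensorRestrictsTo` (`RelativeExponent`);
`IsUniversalSpectralPoint.mono_of_algDegeneratesTo` (`DegenerationSpectralMonotone`);
`gaugePoint₁_isUniversalSpectralPoint` (`AsymptoticSpectrumProofs`), `gaugePoint₁_eq`,
`flatteningRank_multiple_matMulTensor` (`FlatteningRank`).  `lean search 'specMM|matMulSpectrum|
logSpectrum|matMulExponents'` (decl): nothing — the tree had only the one-sided power law and no
statement of Prop. 4.1 / Def. 4.1 / Prop. 4.2 / Prop. 4.5.

## References

* J. Alman, B. Li, *Asymptotic Rank Speedup Theorems, Revisited*, arXiv:2605.21738 (2026), §4.1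
  (Prop. 4.1, Def. 4.1, Prop. 4.2), §4.3 (Prop. 4.5, Rem. 4.2).  [AlmanLi2026]
* V. Strassen, *The asymptotic spectrum of tensors*, J. reine angew. Math. 384 (1988) — the
  attribution [Str88AsymSpec] of Prop. 4.1 / Def. 4.1 in the source.  [Strassen1988]
* M. Christandl, P. Vrana, J. Zuiddam, J. AMS 36 (2023), Prop. 1.6 (Strassen duality).
  [ChristandlVranaZuiddam2023]
* M. Christandl, F. Le Gall, V. Lysikov, J. Zuiddam, *Barriers for rectangular matrix multiplication*,
  comput. complexity (2025), Lemma 3.7 (the one-sided power law reused here).  [ChristandlLeGallLysikovZuiddam2025]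
-/

noncomputable section

open scoped BigOperators

namespace Literature.Computability.AlgebraicComplexity

open Literature.Barriers.MatrixMultiplication (logb_two_mul_log_le_log IsAdequate
  tensorRestrictsTo_matMulTensor_of_le)

/-! ## A. The power law behind Prop. 4.1 -/

section PowerLaw

/-- The upper half of the power law (Alman–Li, proof of Prop. 4.1: from `n^k < 2^{t+1}`,
`φ(⟨n,1,1⟩)^k ≤ φ(⟨2,1,1⟩)^{t+1} ≤ 2^{θ₁} n^{kθ₁}`, then `k`-th roots and `k → ∞`): for `g : ℕ → ℝ`
with `g 1 = 1`, monotone and multiplicative on positive integers, `log g(a) ≤ log₂ g(2) · log a`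
(`a ≥ 1`).  Companion of the tree's lower half `logb_two_mul_log_le_log`.
[cite: AlmanLi2026, Proposition 4.1 (proof)] -/
theorem log_le_logb_two_mul_log {g : ℕ → ℝ} (h1 : g 1 = 1)
    (hmono : ∀ ⦃a b : ℕ⦄, 1 ≤ a → a ≤ b → g a ≤ g b)
    (hmul : ∀ a b : ℕ, 1 ≤ a → 1 ≤ b → g (a * b) = g a * g b) {a : ℕ} (ha : 1 ≤ a) :
    Real.log (g a) ≤ Real.logb 2 (g 2) * Real.log a := by
  have hge : ∀ {n : ℕ}, 1 ≤ n → 1 ≤ g n := fun hn => h1 ▸ hmono le_rfl hn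
  have hpow : ∀ {n : ℕ}, 1 ≤ n → ∀ c : ℕ, g (n ^ c) = g n ^ c := by
    intro n hn c
    induction c with
    | zero => simp [h1]
    | succ c ih => rw [pow_succ, hmul _ _ (Nat.one_le_pow _ _ hn) hn, ih, pow_succ]
  rw [Real.logb]
  set v := Real.log (g 2) with hv_def
  set w := Real.log (g a) with hw_def
  set A := Real.log (a : ℝ) with hA_def
  set L := Real.log (2 : ℝ) with hL_def
  have hL : 0 < L := Real.log_pos one_lt_two
  have hv : 0 ≤ v := Real.log_nonneg (hge (by norm_num))
  have hA : 0 ≤ A := Real.log_nonneg (by exact_mod_cast ha)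
  have ha0 : a ≠ 0 := by omega
  have hapos : (0 : ℝ) < a := by exact_mod_cast Nat.pos_of_ne_zero ha0
  have hg2 : 0 < g 2 := lt_of_lt_of_le one_pos (hge (by norm_num))
  have hga : 0 < g a := lt_of_lt_of_le one_pos (hge ha)
  -- the comparison `2^b ≤ a^c < 2^(b+1)` for every `c ≥ 1`
  have key : ∀ c : ℕ, 1 ≤ c → (c : ℝ) * w ≤ (c * A / L + 1) * v := by
    intro c hc
    set b := Nat.log 2 (a ^ c) with hb_def
    have hac : a ^ c ≠ 0 := pow_ne_zero c ha0
    have h2b : 2 ^ b ≤ a ^ c := Nat.pow_log_le_self 2 hac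
    have hlt : a ^ c < 2 ^ (b + 1) := Nat.lt_pow_succ_log_self one_lt_two _
    have hg : g a ^ c ≤ g 2 ^ (b + 1) := by
      rw [← hpow (by norm_num) (b + 1), ← hpow ha c]
      exact hmono (Nat.one_le_pow _ _ (Nat.pos_of_ne_zero ha0)) hlt.le
    have hlog1 : (c : ℝ) * w ≤ ((b : ℝ) + 1) * v := by
      have := Real.log_le_log (pow_pos hga c) hg
      rw [Real.log_pow, Real.log_pow] at this
      push_cast at this
      exact this
    have hlog2 : (b : ℝ) * L ≤ c * A := by
      have h' : (2 : ℝ) ^ b ≤ ((a : ℝ)) ^ c := by exact_mod_cast h2b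
      have := Real.log_le_log (pow_pos two_pos b) h'
      rw [Real.log_pow, Real.log_pow] at this
      exact this
    have hb' : (b : ℝ) ≤ c * A / L := by
      rw [le_div_iff₀ hL]
      exact hlog2
    calc (c : ℝ) * w ≤ ((b : ℝ) + 1) * v := hlog1
      _ ≤ (c * A / L + 1) * v := mul_le_mul_of_nonneg_right (by linarith) hv
  -- divide by `c` and let `c → ∞`
  have main : ∀ c : ℕ, 1 ≤ c → w ≤ v / L * A + v / c := by
    intro c hc
    have hc' : (0 : ℝ) < c := by exact_mod_cast hc
    have h := key c hc
    rw [← sub_nonneg] at h ⊢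
    have e : v / L * A + v / c - w = ((c * A / L + 1) * v - c * w) / c := by
      field_simp
    rw [e]
    positivity
  refine le_of_forall_pos_lt_add fun δ hδ => ?_
  obtain ⟨c, hc⟩ := exists_nat_gt (v / δ)
  have hc1 : 1 ≤ c + 1 := Nat.le_add_left 1 c
  have hcpos : (0 : ℝ) < ((c + 1 : ℕ) : ℝ) := by positivity
  have h1' := main (c + 1) hc1
  have hsmall : v / ((c + 1 : ℕ) : ℝ) < δ := by
    rw [div_lt_iff₀ hcpos]
    have hvc : v < c * δ := by rwa [div_lt_iff₀ hδ] at hc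
    push_cast
    nlinarith
  linarith

/-- **The power law** (Alman–Li, proof of Prop. 4.1; Strassen 1988): a monotone multiplicative
`g : ℕ → ℝ` with `g 1 = 1` satisfies `g(a) = a^{log₂ g(2)}` for every `a ≥ 1`.
[cite: AlmanLi2026, Proposition 4.1 (proof)] -/
theorem eq_rpow_logb_two {g : ℕ → ℝ} (h1 : g 1 = 1)
    (hmono : ∀ ⦃a b : ℕ⦄, 1 ≤ a → a ≤ b → g a ≤ g b)
    (hmul : ∀ a b : ℕ, 1 ≤ a → 1 ≤ b → g (a * b) = g a * g b) {a : ℕ} (ha : 1 ≤ a) :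
    g a = (a : ℝ) ^ Real.logb 2 (g 2) := by
  have hga : 0 < g a := lt_of_lt_of_le one_pos (h1 ▸ hmono le_rfl ha)
  have hapos : (0 : ℝ) < a := by exact_mod_cast ha
  have hlog : Real.log (g a) = Real.logb 2 (g 2) * Real.log a :=
    le_antisymm (log_le_logb_two_mul_log h1 hmono hmul ha) (logb_two_mul_log_le_log h1 hmono hmul ha)
  rw [Real.rpow_def_of_pos hapos, mul_comm, ← hlog, Real.exp_log hga]

end PowerLaw

/-! ## B. The exponents `(θ₁, θ₂, θ₃)` of a spectral point (Prop. 4.1, Def. 4.1) -/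

section Spectrum

variable (K : Type) [Field K]

/-- The exponents `(θ₁, θ₂, θ₃)` of a map `φ` on tensors along matrix multiplication:
`θ₁ = log₂ φ(⟨2,1,1⟩)`, `θ₂ = log₂ φ(⟨1,2,1⟩)`, `θ₃ = log₂ φ(⟨1,1,2⟩)` (Alman–Li 2026, proof of
Prop. 4.1: "Let `θ₁ = log₂ φ(⟨2,1,1⟩)` …"; `⟨n,m,p⟩ = matMulTensor K n m p`).  For a point of the
asymptotic spectrum these are the unique reals with `φ(⟨n,m,p⟩) = n^{θ₁} m^{θ₂} p^{θ₃}`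
(`AlmanLi2026.prop41`, `AlmanLi2026.prop41_unique`). [cite: AlmanLi2026, Proposition 4.1] -/
def specMMPoint (F : SpectralMap K) : Fin 3 → ℝ :=
  ![Real.logb 2 (F (matMulTensor K 2 1 1)), Real.logb 2 (F (matMulTensor K 1 2 1)),
    Real.logb 2 (F (matMulTensor K 1 1 2))]

/-- **The (logarithmic) spectrum of matrix multiplication** `specMM ⊂ ℝ³` (Alman–Li 2026, Def. 4.1,
after Strassen 1988): the set of exponent triples `(θ₁, θ₂, θ₃)(φ)` of the points `φ` of the asymptotic
spectrum of tensors over `K` (the tree's `IsUniversalSpectralPoint K`). [cite: AlmanLi2026, Definition 4.1] -/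
def specMM : Set (Fin 3 → ℝ) :=
  {θ | ∃ F : SpectralMap K, IsUniversalSpectralPoint K F ∧ specMMPoint K F = θ}

variable {K}

/-- `θ₁ = log₂ φ(⟨2,1,1⟩)` (unfolding). [cite: AlmanLi2026, Proposition 4.1 (proof)] -/
@[simp] theorem specMMPoint_zero (F : SpectralMap K) :
    specMMPoint K F 0 = Real.logb 2 (F (matMulTensor K 2 1 1)) := rfl

/-- `θ₂ = log₂ φ(⟨1,2,1⟩)` (unfolding). [cite: AlmanLi2026, Proposition 4.1 (proof)] -/
@[simp] theorem specMMPoint_one (F : SpectralMap K) :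
    specMMPoint K F 1 = Real.logb 2 (F (matMulTensor K 1 2 1)) := rfl

/-- `θ₃ = log₂ φ(⟨1,1,2⟩)` (unfolding). [cite: AlmanLi2026, Proposition 4.1 (proof)] -/
@[simp] theorem specMMPoint_two (F : SpectralMap K) :
    specMMPoint K F 2 = Real.logb 2 (F (matMulTensor K 1 1 2)) := rfl

/-- Membership in `specMM`, unfolded. [cite: AlmanLi2026, Definition 4.1] -/
theorem mem_specMM_iff (θ : Fin 3 → ℝ) :
    θ ∈ specMM K ↔ ∃ F : SpectralMap K, IsUniversalSpectralPoint K F ∧ specMMPoint K F = θ :=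
  Iff.rfl

/-- The exponent triple of a spectral point lies in `specMM`. [cite: AlmanLi2026, Definition 4.1] -/
theorem specMMPoint_mem_specMM {F : SpectralMap K} (hF : IsUniversalSpectralPoint K F) :
    specMMPoint K F ∈ specMM K :=
  ⟨F, hF, rfl⟩

/-- The sum `θ₁ + θ₂ + θ₃` over `Fin 3`. [folklore] -/
private theorem sum_specMMPoint (F : SpectralMap K) :
    ∑ i, specMMPoint K F i = specMMPoint K F 0 + specMMPoint K F 1 + specMMPoint K F 2 := by
  rw [Fin.sum_univ_three]

namespace IsUniversalSpectralPoint

variable {F : SpectralMap K} (hF : IsUniversalSpectralPoint K F)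
include hF

/-- A universal spectral point is an adequate map in the sense of CLLZ (tree, footnote 3), Strassen
duality being proved in the tree. [cite: ChristandlLeGallLysikovZuiddam2025, §1.3.1 (footnote 3)] -/
theorem isAdequate' : IsAdequate K F :=
  hF.isAdequate (strassen_duality_asymptoticRank_holds K)

/-- `φ(⟨1,1,1⟩) = 1` (CLLZ Def. 3.1 / tree `IsAdequate.map_matMul_one`, here for a universal spectral
point, which does not vanish at `⟨1⟩`). [cite: ChristandlLeGallLysikovZuiddam2025, Def. 3.1] -/
theorem map_matMulTensor_one_one_one : F (matMulTensor K 1 1 1) = 1 :=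
  hF.isAdequate'.map_matMul_one (T := unitTensor K 1) (by rw [hF.map_unitTensor_one]; norm_num)

/-- `φ(⟨n,m,p⟩) ≥ 1` for positive formats (monotonicity from `⟨1,1,1⟩`; CLLZ Def. 3.1 / tree
`IsAdequate.one_le_map_matMul`). [cite: ChristandlLeGallLysikovZuiddam2025, Def. 3.1] -/
theorem one_le_map_matMulTensor {n m p : ℕ} (hn : 1 ≤ n) (hm : 1 ≤ m) (hp : 1 ≤ p) :
    1 ≤ F (matMulTensor K n m p) :=
  hF.isAdequate'.one_le_map_matMul hF.map_matMulTensor_one_one_one hn hm hp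

/-- **Prop. 4.1, first family**: `φ(⟨n,1,1⟩) = n^{θ₁}` for `n ≥ 1` (the family `n ↦ φ(⟨n,1,1⟩)` is
monotone — zero-padding is a restriction — multiplicative — `⟨n,1,1⟩ ⊗ ⟨n',1,1⟩ ≅ ⟨nn',1,1⟩` — and
`φ(⟨1,1,1⟩) = 1`). [cite: AlmanLi2026, Proposition 4.1 (proof)] -/
theorem map_matMulTensor_line₁ {n : ℕ} (hn : 1 ≤ n) :
    F (matMulTensor K n 1 1) = (n : ℝ) ^ specMMPoint K F 0 := by
  have hA := hF.isAdequate'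
  exact eq_rpow_logb_two (g := fun a => F (matMulTensor K a 1 1)) hF.map_matMulTensor_one_one_one
    (fun a b _ hab => hA.map_matMul_mono hab le_rfl le_rfl)
    (fun a b ha hb => by
      have h := hA.mamu a b 1 1 1 1 ha hb le_rfl le_rfl le_rfl le_rfl
      rwa [SpectralMap.map_matMulTensor_congr F rfl (Nat.mul_one 1) (Nat.mul_one 1)] at h) hn

/-- **Prop. 4.1, second family**: `φ(⟨1,m,1⟩) = m^{θ₂}` for `m ≥ 1`. [cite: AlmanLi2026, Proposition 4.1 (proof)] -/
theorem map_matMulTensor_line₂ {m : ℕ} (hm : 1 ≤ m) :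
    F (matMulTensor K 1 m 1) = (m : ℝ) ^ specMMPoint K F 1 := by
  have hA := hF.isAdequate'
  exact eq_rpow_logb_two (g := fun a => F (matMulTensor K 1 a 1)) hF.map_matMulTensor_one_one_one
    (fun a b _ hab => hA.map_matMul_mono le_rfl hab le_rfl)
    (fun a b ha hb => by
      have h := hA.mamu 1 1 a b 1 1 le_rfl le_rfl ha hb le_rfl le_rfl
      rwa [SpectralMap.map_matMulTensor_congr F (Nat.mul_one 1) rfl (Nat.mul_one 1)] at h) hm

/-- **Prop. 4.1, third family**: `φ(⟨1,1,p⟩) = p^{θ₃}` for `p ≥ 1`. [cite: AlmanLi2026, Proposition 4.1 (proof)] -/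
theorem map_matMulTensor_line₃ {p : ℕ} (hp : 1 ≤ p) :
    F (matMulTensor K 1 1 p) = (p : ℝ) ^ specMMPoint K F 2 := by
  have hA := hF.isAdequate'
  exact eq_rpow_logb_two (g := fun a => F (matMulTensor K 1 1 a)) hF.map_matMulTensor_one_one_one
    (fun a b _ hab => hA.map_matMul_mono le_rfl le_rfl hab)
    (fun a b ha hb => by
      have h := hA.mamu 1 1 1 1 a b le_rfl le_rfl le_rfl le_rfl ha hb
      rwa [SpectralMap.map_matMulTensor_congr F (Nat.mul_one 1) (Nat.mul_one 1) rfl] at h) hp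

/-- The value on `⟨n,n,n⟩` is `n^{θ₁+θ₂+θ₃}` (`n ≥ 1`; proof of Prop. 4.2: "The value
`θ₁ + θ₂ + θ₃`, by definition, equals `log_n φ(⟨n,n,n⟩)`"). [cite: AlmanLi2026, Proposition 4.2 (proof)] -/
theorem map_matMulTensor_cube {n : ℕ} (hn : 1 ≤ n) :
    F (matMulTensor K n n n) = (n : ℝ) ^ ∑ i, specMMPoint K F i := by
  have hn0 : (0 : ℝ) < n := by exact_mod_cast hn
  rw [hF.isAdequate'.map_matMul_eq_mul₃ hn hn hn, hF.map_matMulTensor_line₁ hn,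
    hF.map_matMulTensor_line₂ hn, hF.map_matMulTensor_line₃ hn, sum_specMMPoint,
    Real.rpow_add hn0, Real.rpow_add hn0]

end IsUniversalSpectralPoint

/-- **Alman–Li 2026, Proposition 4.1** ([Str88AsymSpec]): for every point `φ` of the asymptotic
spectrum, `φ(⟨n,m,p⟩) = n^{θ₁} m^{θ₂} p^{θ₃}` for all `n, m, p ≥ 1`, where
`(θ₁, θ₂, θ₃) = specMMPoint K φ` (`= (log₂ φ(⟨2,1,1⟩), log₂ φ(⟨1,2,1⟩), log₂ φ(⟨1,1,2⟩))`).  Proof as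
printed: the three one-parameter families are monotone and multiplicative, hence power laws
(`eq_rpow_logb_two`), and `⟨n,m,p⟩ ≅ ⟨n,1,1⟩ ⊗ ⟨1,m,1⟩ ⊗ ⟨1,1,p⟩`.  (Positive formats: for `n = 0`
the tensor is zero and `φ = 0`.) [cite: AlmanLi2026, Proposition 4.1] -/
theorem AlmanLi2026.prop41 {F : SpectralMap K} (hF : IsUniversalSpectralPoint K F) {n m p : ℕ}
    (hn : 1 ≤ n) (hm : 1 ≤ m) (hp : 1 ≤ p) :
    F (matMulTensor K n m p) =
      (n : ℝ) ^ specMMPoint K F 0 * (m : ℝ) ^ specMMPoint K F 1 * (p : ℝ) ^ specMMPoint K F 2 := by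
  rw [hF.isAdequate'.map_matMul_eq_mul₃ hn hm hp, hF.map_matMulTensor_line₁ hn,
    hF.map_matMulTensor_line₂ hm, hF.map_matMulTensor_line₃ hp]

/-- **Prop. 4.1, uniqueness**: exponents `(a, b, c)` with `φ(⟨n,m,p⟩) = nᵃ mᵇ pᶜ` for all positive
formats are the `θᵢ` (evaluate at `(2,1,1)`, `(1,2,1)`, `(1,1,2)`). [cite: AlmanLi2026, Proposition 4.1] -/
theorem AlmanLi2026.prop41_unique {F : SpectralMap K} (θ : Fin 3 → ℝ)
    (h : ∀ n m p : ℕ, 1 ≤ n → 1 ≤ m → 1 ≤ p →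
      F (matMulTensor K n m p) = (n : ℝ) ^ θ 0 * (m : ℝ) ^ θ 1 * (p : ℝ) ^ θ 2) :
    θ = specMMPoint K F := by
  have h₁ := h 2 1 1 (by norm_num) le_rfl le_rfl
  have h₂ := h 1 2 1 le_rfl (by norm_num) le_rfl
  have h₃ := h 1 1 2 le_rfl le_rfl (by norm_num)
  simp only [Nat.cast_one, Real.one_rpow, mul_one, one_mul, Nat.cast_ofNat] at h₁ h₂ h₃
  funext i
  fin_cases i
  · show θ 0 = specMMPoint K F 0
    rw [specMMPoint_zero, h₁, Real.logb_rpow two_pos (by norm_num)]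
  · show θ 1 = specMMPoint K F 1
    rw [specMMPoint_one, h₂, Real.logb_rpow two_pos (by norm_num)]
  · show θ 2 = specMMPoint K F 2
    rw [specMMPoint_two, h₃, Real.logb_rpow two_pos (by norm_num)]

/-- **Prop. 4.1 as printed — "there exist unique real numbers `θ₁, θ₂, θ₃` such that
`φ(⟨n,m,p⟩) = n^{θ₁} m^{θ₂} p^{θ₃}` for any `n, m, p`"** (positive formats). [cite: AlmanLi2026, Proposition 4.1] -/
theorem AlmanLi2026.prop41_existsUnique {F : SpectralMap K} (hF : IsUniversalSpectralPoint K F) :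
    ∃! θ : Fin 3 → ℝ, ∀ n m p : ℕ, 1 ≤ n → 1 ≤ m → 1 ≤ p →
      F (matMulTensor K n m p) = (n : ℝ) ^ θ 0 * (m : ℝ) ^ θ 1 * (p : ℝ) ^ θ 2 :=
  ⟨specMMPoint K F, fun _ _ _ hn hm hp => AlmanLi2026.prop41 hF hn hm hp,
    fun θ hθ => AlmanLi2026.prop41_unique θ hθ⟩

/-! ## C. Prop. 4.2: `θᵢ ∈ [0,1]`, `2 ≤ θ₁ + θ₂ + θ₃ ≤ ω`, both extremes attained -/

/-- **Prop. 4.2, first part**: every `θᵢ` lies in `[0, 1]` — `1 = φ(⟨1,1,1⟩) ≤ φ(⟨2,1,1⟩) ≤ φ(⟨2⟩) = 2`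
(zero-padding `⟨1,1,1⟩ ≤ ⟨2,1,1⟩`; `⟨2,1,1⟩ ≤ ⟨2⟩` since `R(⟨2,1,1⟩) ≤ 2`), and the same in the other
two directions. [cite: AlmanLi2026, Proposition 4.2] -/
theorem AlmanLi2026.prop42_mem_Icc {F : SpectralMap K} (hF : IsUniversalSpectralPoint K F) (i : Fin 3) :
    specMMPoint K F i ∈ Set.Icc (0 : ℝ) 1 := by
  -- `1 ≤ φ(⟨k,m,n⟩) ≤ 2` for the three formats with `kmn = 2`
  have hup : ∀ {k m n : ℕ}, k * m * n = 2 → F (matMulTensor K k m n) ≤ 2 := by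
    intro k m n hkmn
    have hR : tensorRank (matMulTensor K k m n) ≤ 2 := hkmn ▸ tensorRank_matMulTensor_le K k m n
    calc F (matMulTensor K k m n) ≤ F (unitTensor K 2) :=
          hF.mono _ _ (tensorRestrictsTo_unitTensor_of_tensorRank_le _ hR)
      _ = 2 := by rw [hF.map_unitTensor]; norm_num
  have key : ∀ {x : ℝ}, 1 ≤ x → x ≤ 2 → Real.logb 2 x ∈ Set.Icc (0 : ℝ) 1 := by
    intro x h1 h2
    refine ⟨Real.logb_nonneg one_lt_two h1, ?_⟩
    calc Real.logb 2 x ≤ Real.logb 2 2 := Real.logb_le_logb_of_le one_lt_two (by linarith) h2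
      _ = 1 := Real.logb_self_eq_one one_lt_two
  fin_cases i
  · exact key (hF.one_le_map_matMulTensor (by norm_num) le_rfl le_rfl) (hup (by norm_num))
  · exact key (hF.one_le_map_matMulTensor le_rfl (by norm_num) le_rfl) (hup (by norm_num))
  · exact key (hF.one_le_map_matMulTensor le_rfl le_rfl (by norm_num)) (hup (by norm_num))

/-- **Prop. 4.2: `θ₁ + θ₂ + θ₃ ≤ ω`** for every spectral point — `2^{θ₁+θ₂+θ₃} = φ(⟨2,2,2⟩) ≤
R̃(⟨2,2,2⟩) = 2^ω` (easy half of Strassen duality; `R̃(⟨n,n,n⟩) = n^ω`, tree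
`asymptoticRank_matMulTensor`). [cite: AlmanLi2026, Proposition 4.2] -/
theorem AlmanLi2026.prop42_sum_le_omega {F : SpectralMap K} (hF : IsUniversalSpectralPoint K F) :
    ∑ i, specMMPoint K F i ≤ omega K := by
  have h : (2 : ℝ) ^ ∑ i, specMMPoint K F i ≤ (2 : ℝ) ^ omega K := by
    have h1 := (strassen_duality_asymptoticRank_holds K (matMulTensor K 2 2 2)).1 F hF
    rw [asymptoticRank_matMulTensor K 2 (by norm_num), hF.map_matMulTensor_cube (by norm_num)] at h1
    exact_mod_cast h1
  exact (Real.rpow_le_rpow_left_iff one_lt_two).1 h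

/-- **Prop. 4.2 / Rem. 4.2: `θ₁ + θ₂ + θ₃ ≥ 2`** for every spectral point ("ultimately comes from the
optimal asymptotic subrank bound `Q̃(⟨n,n,n⟩) = n²`").  Here from the tree's
`exists_tensorMonRestrictsTo_matMulTensor_unitTensor` (`⟨n,n,n⟩ ≥ ⟨R⟩` with `R ≥ n^{2−ε}` for all
large `n`, Behrend / Ruzsa–Szemerédi): `n^{θ₁+θ₂+θ₃} = φ(⟨n,n,n⟩) ≥ φ(⟨R⟩) = R ≥ n^{2−ε}`, so
`θ₁ + θ₂ + θ₃ ≥ 2 − ε` for every `ε > 0`. [cite: AlmanLi2026, Proposition 4.2] -/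
theorem AlmanLi2026.prop42_two_le_sum {F : SpectralMap K} (hF : IsUniversalSpectralPoint K F) :
    2 ≤ ∑ i, specMMPoint K F i := by
  set θ := ∑ i, specMMPoint K F i with hθ
  -- `θ ≥ 2 - ε` for every `0 < ε ≤ 1`
  have hε : ∀ ε : ℝ, 0 < ε → ε ≤ 1 → 2 - ε ≤ θ := by
    intro ε hε hε1
    obtain ⟨n₀, hn₀⟩ := exists_tensorMonRestrictsTo_matMulTensor_unitTensor K hε hε1
    obtain ⟨R, hR, hres⟩ := hn₀ (max n₀ 2) (le_max_left _ _)
    have hn2 : 2 ≤ max n₀ 2 := le_max_right _ _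
    have hn1 : (1 : ℝ) < (max n₀ 2 : ℕ) := by exact_mod_cast hn2
    have h1 : (R : ℝ) ≤ F (matMulTensor K (max n₀ 2) (max n₀ 2) (max n₀ 2)) := by
      rw [← hF.map_unitTensor R]
      exact hF.mono _ _ hres.tensorRestrictsTo
    rw [hF.map_matMulTensor_cube (le_trans (by norm_num) hn2)] at h1
    exact (Real.rpow_le_rpow_left_iff hn1).1 (hR.trans h1)
  -- let `ε → 0`
  refine le_of_forall_pos_lt_add fun δ hδ => ?_
  have h := hε (min δ 1 / 2) (by positivity) (by
    have := min_le_right δ 1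
    linarith)
  have : min δ 1 / 2 < δ := by
    have := min_le_left δ 1
    linarith [lt_min hδ one_pos]
  linarith

/-- Prop. 4.2 for points of `specMM`: every coordinate in `[0,1]` and `2 ≤ θ₁ + θ₂ + θ₃ ≤ ω`.
[cite: AlmanLi2026, Proposition 4.2] -/
theorem AlmanLi2026.prop42 {θ : Fin 3 → ℝ} (hθ : θ ∈ specMM K) :
    (∀ i, θ i ∈ Set.Icc (0 : ℝ) 1) ∧ 2 ≤ ∑ i, θ i ∧ ∑ i, θ i ≤ omega K := by
  obtain ⟨F, hF, rfl⟩ := hθ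
  exact ⟨AlmanLi2026.prop42_mem_Icc hF, AlmanLi2026.prop42_two_le_sum hF,
    AlmanLi2026.prop42_sum_le_omega hF⟩

/-- **Prop. 4.2: the maximum of `θ₁ + θ₂ + θ₃` over `specMM` is `ω`** — attained at a spectral point
with `φ(⟨2,2,2⟩) = R̃(⟨2,2,2⟩) = 2^ω` (Strassen duality, tree `strassen_duality_asymptoticRank_holds`).
[cite: AlmanLi2026, Proposition 4.2] -/
theorem AlmanLi2026.prop42_isGreatest :
    IsGreatest ((fun θ : Fin 3 → ℝ => ∑ i, θ i) '' specMM K) (omega K) := by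
  refine ⟨?_, ?_⟩
  · obtain ⟨F, hF, hFt⟩ := (strassen_duality_asymptoticRank_holds K (matMulTensor K 2 2 2)).2
    refine ⟨specMMPoint K F, specMMPoint_mem_specMM hF, ?_⟩
    show ∑ i, specMMPoint K F i = omega K
    rw [asymptoticRank_matMulTensor K 2 (by norm_num), hF.map_matMulTensor_cube (by norm_num)] at hFt
    have hFt' : (2 : ℝ) ^ ∑ i, specMMPoint K F i = (2 : ℝ) ^ omega K := by exact_mod_cast hFt
    exact le_antisymm (AlmanLi2026.prop42_sum_le_omega hF)
      ((Real.rpow_le_rpow_left_iff one_lt_two).1 hFt'.ge)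
  · rintro _ ⟨θ, hθ, rfl⟩
    exact (AlmanLi2026.prop42 hθ).2.2

/-- **Prop. 4.2: the minimum of `θ₁ + θ₂ + θ₃` over `specMM` is `2`** — attained at the gauge point
`ζ⁽¹⁾` (a flattening rank, a universal spectral point by the tree's
`gaugePoint₁_isUniversalSpectralPoint`), `ζ⁽¹⁾(⟨n,n,n⟩) = n²` (`flatteningRank_multiple_matMulTensor`).
[cite: AlmanLi2026, Proposition 4.2] -/
theorem AlmanLi2026.prop42_isLeast :
    IsLeast ((fun θ : Fin 3 → ℝ => ∑ i, θ i) '' specMM K) 2 := by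
  refine ⟨?_, ?_⟩
  · have hG := gaugePoint₁_isUniversalSpectralPoint K
    refine ⟨specMMPoint K (gaugePoint₁ K), specMMPoint_mem_specMM hG, ?_⟩
    show ∑ i, specMMPoint K (gaugePoint₁ K) i = 2
    -- `ζ⁽¹⁾(⟨2,2,2⟩) = ζ⁽¹⁾(⟨1⟩ ⊗ ⟨2,2,2⟩) = 1 · (2 · 2) = 4 = 2²`
    have h4 : gaugePoint₁ K (matMulTensor K 2 2 2) = 4 := by
      have h := hG.map_kronecker (unitTensor K 1) (matMulTensor K 2 2 2)
      rw [hG.map_unitTensor_one, one_mul, gaugePoint₁_eq,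
        flatteningRank_multiple_matMulTensor 1 2 2 2 (by norm_num)] at h
      rw [← h]; norm_num
    have hcube := hG.map_matMulTensor_cube (n := 2) (by norm_num)
    rw [h4] at hcube
    have hcube' : (4 : ℝ) = (2 : ℝ) ^ ∑ i, specMMPoint K (gaugePoint₁ K) i := by
      exact_mod_cast hcube
    have e : (2 : ℝ) ^ ∑ i, specMMPoint K (gaugePoint₁ K) i = (2 : ℝ) ^ (2 : ℝ) := by
      rw [← hcube']; norm_num
    exact le_antisymm ((Real.rpow_le_rpow_left_iff one_lt_two).1 e.le)
      ((Real.rpow_le_rpow_left_iff one_lt_two).1 e.ge)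
  · rintro _ ⟨θ, hθ, rfl⟩
    exact (AlmanLi2026.prop42 hθ).2.1

/-! ## D. Prop. 4.5 (the "complicated example" of Strassen calculus) -/

/-- `τ(x) = sˣ − tˣ` is monotone increasing on `[0, ∞)` when `1 ≤ t ≤ s` (proof of Prop. 4.5, Case 2;
with the roles of `s, t` exchanged it is Case 1's "`τ` is decreasing"). [cite: AlmanLi2026, Proposition 4.5 (proof)] -/
theorem rpow_sub_rpow_le_rpow_sub_rpow {s t x y : ℝ} (ht : 1 ≤ t) (hts : t ≤ s) (hx : 0 ≤ x)
    (hxy : x ≤ y) : s ^ x - t ^ x ≤ s ^ y - t ^ y := by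
  have hs : 1 ≤ s := ht.trans hts
  have hs0 : 0 < s := by linarith
  have ht0 : 0 < t := by linarith
  have e1 : s ^ y = s ^ x * s ^ (y - x) := by rw [← Real.rpow_add hs0]; ring_nf
  have e2 : t ^ y = t ^ x * t ^ (y - x) := by rw [← Real.rpow_add ht0]; ring_nf
  have h1 : t ^ x ≤ s ^ x := Real.rpow_le_rpow ht0.le hts hx
  have h2 : 1 ≤ t ^ (y - x) := Real.one_le_rpow ht (by linarith)
  have h3 : t ^ (y - x) ≤ s ^ (y - x) := Real.rpow_le_rpow ht0.le hts (by linarith)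
  have h4 : 0 ≤ t ^ x := (Real.rpow_pos_of_pos ht0 x).le
  -- `t^x (t^{y-x} - 1) ≤ s^x (s^{y-x} - 1)`
  nlinarith [mul_le_mul h1 (sub_le_sub_right h3 1) (by linarith) (h4.trans h1)]

section Prop45

variable {ι κ μ : Type} [Fintype ι] [Fintype κ] [Fintype μ]

/-- One direction of the hypothesis of Prop. 4.5 evaluated at a spectral point:
`T ⊕ X ⊴ ⟨r⟩ ⊕ Y ⟹ φ(T) + φ(X) ≤ r + φ(Y)` ("apply `φ` to (eq:degen_i)": monotonicity, additivity,
`φ(⟨r⟩) = r`). [cite: AlmanLi2026, Proposition 4.5 (proof)] -/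
theorem IsUniversalSpectralPoint.add_le_add_of_algDegeneratesTo {F : SpectralMap K}
    (hF : IsUniversalSpectralPoint K F) {ι₁ κ₁ μ₁ ι₂ κ₂ μ₂ : Type} [Fintype ι₁] [Fintype κ₁]
    [Fintype μ₁] [Fintype ι₂] [Fintype κ₂] [Fintype μ₂] {T : ι → κ → μ → K} {X : ι₁ → κ₁ → μ₁ → K}
    {Y : ι₂ → κ₂ → μ₂ → K} {r : ℕ}
    (h : AlgDegeneratesTo (directSumTensor (unitTensor K r) Y) (directSumTensor T X)) :
    F T + F X ≤ r + F Y := by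
  have h1 := hF.mono_of_algDegeneratesTo h
  rwa [hF.map_directSum, hF.map_directSum, hF.map_unitTensor] at h1

/-- **Alman–Li 2026, Proposition 4.5, Case 2 (`t ≤ s`)**: if `T ⊕ ⟨t,1,1⟩ ⊴ ⟨r⟩ ⊕ ⟨s,1,1⟩`,
`T ⊕ ⟨1,t,1⟩ ⊴ ⟨r⟩ ⊕ ⟨1,s,1⟩`, `T ⊕ ⟨1,1,t⟩ ⊴ ⟨r⟩ ⊕ ⟨1,1,s⟩` with `1 ≤ t ≤ s`, then
`R̃(T) ≤ r + s^{ω/3} − t^{ω/3}`.  Proof as printed: for a spectral point `φ`,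
`φ(T) ≤ r + s^{θᵢ} − t^{θᵢ}` for each `i` (Prop. 4.1); `τ(x) = sˣ − tˣ` is increasing and
`minᵢ θᵢ ≤ (θ₁+θ₂+θ₃)/3 ≤ ω/3` (Prop. 4.2), so `φ(T) ≤ r + τ(ω/3)`; then Strassen duality
(`strassen_duality_asymptoticRank_holds`).  The three lines are the tree's `matMulTensor K · 1 1`,
`matMulTensor K 1 · 1`, `matMulTensor K 1 1 ·`. [cite: AlmanLi2026, Proposition 4.5] -/
theorem AlmanLi2026.prop45_of_le (T : ι → κ → μ → K) {r s t : ℕ} (ht : 1 ≤ t) (hts : t ≤ s)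
    (h₁ : AlgDegeneratesTo (directSumTensor (unitTensor K r) (matMulTensor K s 1 1))
      (directSumTensor T (matMulTensor K t 1 1)))
    (h₂ : AlgDegeneratesTo (directSumTensor (unitTensor K r) (matMulTensor K 1 s 1))
      (directSumTensor T (matMulTensor K 1 t 1)))
    (h₃ : AlgDegeneratesTo (directSumTensor (unitTensor K r) (matMulTensor K 1 1 s))
      (directSumTensor T (matMulTensor K 1 1 t))) :
    asymptoticRank T ≤ r + ((s : ℝ) ^ (omega K / 3) - (t : ℝ) ^ (omega K / 3)) := by
  have hs : 1 ≤ s := ht.trans hts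
  have ht' : (1 : ℝ) ≤ t := by exact_mod_cast ht
  have hts' : (t : ℝ) ≤ s := by exact_mod_cast hts
  refine strassen_duality_asymptoticRank.asymptoticRank_le (strassen_duality_asymptoticRank_holds K) T
    fun F hF => ?_
  -- the three spectral inequalities `φ(T) ≤ r + s^{θᵢ} - t^{θᵢ}`
  have e₁ := hF.add_le_add_of_algDegeneratesTo h₁
  have e₂ := hF.add_le_add_of_algDegeneratesTo h₂
  have e₃ := hF.add_le_add_of_algDegeneratesTo h₃
  rw [hF.map_matMulTensor_line₁ ht, hF.map_matMulTensor_line₁ hs] at e₁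
  rw [hF.map_matMulTensor_line₂ ht, hF.map_matMulTensor_line₂ hs] at e₂
  rw [hF.map_matMulTensor_line₃ ht, hF.map_matMulTensor_line₃ hs] at e₃
  set θ := specMMPoint K F with hθdef
  -- the minimal exponent `θ i₀ ≤ ω/3`
  obtain ⟨i₀, -, hi₀⟩ := Finset.exists_min_image Finset.univ θ Finset.univ_nonempty
  have hmin_le : θ i₀ ≤ omega K / 3 := by
    have hsum : ∑ i, θ i ≤ omega K := AlmanLi2026.prop42_sum_le_omega hF
    have h3 : 3 * θ i₀ ≤ ∑ i, θ i := by
      rw [Fin.sum_univ_three]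
      linarith [hi₀ 0 (Finset.mem_univ _), hi₀ 1 (Finset.mem_univ _), hi₀ 2 (Finset.mem_univ _)]
    linarith
  have hθ0 : 0 ≤ θ i₀ := (AlmanLi2026.prop42_mem_Icc hF i₀).1
  have hτ : (s : ℝ) ^ θ i₀ - (t : ℝ) ^ θ i₀ ≤ (s : ℝ) ^ (omega K / 3) - (t : ℝ) ^ (omega K / 3) :=
    rpow_sub_rpow_le_rpow_sub_rpow ht' hts' hθ0 hmin_le
  have hTi : F T ≤ r + ((s : ℝ) ^ θ i₀ - (t : ℝ) ^ θ i₀) := by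
    fin_cases i₀
    · change F T ≤ r + ((s : ℝ) ^ θ 0 - (t : ℝ) ^ θ 0); linarith
    · change F T ≤ r + ((s : ℝ) ^ θ 1 - (t : ℝ) ^ θ 1); linarith
    · change F T ≤ r + ((s : ℝ) ^ θ 2 - (t : ℝ) ^ θ 2); linarith
  linarith

/-- **Alman–Li 2026, Proposition 4.5, Case 1 (`t > s`)**: under the same three degenerations with
`1 ≤ s < t`, `R̃(T) ≤ r + s^{2/3} − t^{2/3}`.  Proof as printed: `τ(x) = sˣ − tˣ` is now decreasing,
`minᵢ τ(θᵢ) = τ(maxᵢ θᵢ)`, and `maxᵢ θᵢ ≥ 2/3` because `θ₁ + θ₂ + θ₃ ≥ 2` (Prop. 4.2 / Rem. 4.2: "it can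
turn lower bounds into upper bounds … ultimately comes from `Q̃(⟨n,n,n⟩) = n²`"); then Strassen
duality. [cite: AlmanLi2026, Proposition 4.5] -/
theorem AlmanLi2026.prop45_of_lt (T : ι → κ → μ → K) {r s t : ℕ} (hs : 1 ≤ s) (hst : s < t)
    (h₁ : AlgDegeneratesTo (directSumTensor (unitTensor K r) (matMulTensor K s 1 1))
      (directSumTensor T (matMulTensor K t 1 1)))
    (h₂ : AlgDegeneratesTo (directSumTensor (unitTensor K r) (matMulTensor K 1 s 1))
      (directSumTensor T (matMulTensor K 1 t 1)))
    (h₃ : AlgDegeneratesTo (directSumTensor (unitTensor K r) (matMulTensor K 1 1 s))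
      (directSumTensor T (matMulTensor K 1 1 t))) :
    asymptoticRank T ≤ r + ((s : ℝ) ^ (2 / 3 : ℝ) - (t : ℝ) ^ (2 / 3 : ℝ)) := by
  have ht : 1 ≤ t := hs.trans hst.le
  have hs' : (1 : ℝ) ≤ s := by exact_mod_cast hs
  have hst' : (s : ℝ) ≤ t := by exact_mod_cast hst.le
  refine strassen_duality_asymptoticRank.asymptoticRank_le (strassen_duality_asymptoticRank_holds K) T
    fun F hF => ?_
  have e₁ := hF.add_le_add_of_algDegeneratesTo h₁
  have e₂ := hF.add_le_add_of_algDegeneratesTo h₂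
  have e₃ := hF.add_le_add_of_algDegeneratesTo h₃
  rw [hF.map_matMulTensor_line₁ ht, hF.map_matMulTensor_line₁ hs] at e₁
  rw [hF.map_matMulTensor_line₂ ht, hF.map_matMulTensor_line₂ hs] at e₂
  rw [hF.map_matMulTensor_line₃ ht, hF.map_matMulTensor_line₃ hs] at e₃
  set θ := specMMPoint K F with hθdef
  -- the maximal exponent `θ i₀ ≥ 2/3`
  obtain ⟨i₀, -, hi₀⟩ := Finset.exists_max_image Finset.univ θ Finset.univ_nonempty
  have hle_max : 2 / 3 ≤ θ i₀ := by
    have hsum : 2 ≤ ∑ i, θ i := AlmanLi2026.prop42_two_le_sum hF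
    have h3 : ∑ i, θ i ≤ 3 * θ i₀ := by
      rw [Fin.sum_univ_three]
      linarith [hi₀ 0 (Finset.mem_univ _), hi₀ 1 (Finset.mem_univ _), hi₀ 2 (Finset.mem_univ _)]
    linarith
  -- `τ` decreasing: `t^{2/3} - s^{2/3} ≤ t^{θ i₀} - s^{θ i₀}`
  have hτ : (t : ℝ) ^ (2 / 3 : ℝ) - (s : ℝ) ^ (2 / 3 : ℝ) ≤ (t : ℝ) ^ θ i₀ - (s : ℝ) ^ θ i₀ :=
    rpow_sub_rpow_le_rpow_sub_rpow hs' hst' (by norm_num) hle_max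
  have hTi : F T ≤ r + ((s : ℝ) ^ θ i₀ - (t : ℝ) ^ θ i₀) := by
    fin_cases i₀
    · change F T ≤ r + ((s : ℝ) ^ θ 0 - (t : ℝ) ^ θ 0); linarith
    · change F T ≤ r + ((s : ℝ) ^ θ 1 - (t : ℝ) ^ θ 1); linarith
    · change F T ≤ r + ((s : ℝ) ^ θ 2 - (t : ℝ) ^ θ 2); linarith
  linarith

/-- **Alman–Li 2026, Proposition 4.5** (both cases, as printed): if `T ⊕ ⟨t,1,1⟩ ⊴ ⟨r⟩ ⊕ ⟨s,1,1⟩`,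
`T ⊕ ⟨1,t,1⟩ ⊴ ⟨r⟩ ⊕ ⟨1,s,1⟩`, `T ⊕ ⟨1,1,t⟩ ⊴ ⟨r⟩ ⊕ ⟨1,1,s⟩` for some `s, t ≥ 1`, then
`R̃(T) ≤ r + s^{2/3} − t^{2/3}` if `t > s` and `R̃(T) ≤ r + s^{ω/3} − t^{ω/3}` if `t ≤ s`.
[cite: AlmanLi2026, Proposition 4.5] -/
theorem AlmanLi2026.prop45 (T : ι → κ → μ → K) {r s t : ℕ} (hs : 1 ≤ s) (ht : 1 ≤ t)
    (h₁ : AlgDegeneratesTo (directSumTensor (unitTensor K r) (matMulTensor K s 1 1))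
      (directSumTensor T (matMulTensor K t 1 1)))
    (h₂ : AlgDegeneratesTo (directSumTensor (unitTensor K r) (matMulTensor K 1 s 1))
      (directSumTensor T (matMulTensor K 1 t 1)))
    (h₃ : AlgDegeneratesTo (directSumTensor (unitTensor K r) (matMulTensor K 1 1 s))
      (directSumTensor T (matMulTensor K 1 1 t))) :
    asymptoticRank T ≤
      if s < t then r + ((s : ℝ) ^ (2 / 3 : ℝ) - (t : ℝ) ^ (2 / 3 : ℝ))
      else r + ((s : ℝ) ^ (omega K / 3) - (t : ℝ) ^ (omega K / 3)) := by
  split_ifs with hst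
  · exact AlmanLi2026.prop45_of_lt T hs hst h₁ h₂ h₃
  · exact AlmanLi2026.prop45_of_le T ht (not_lt.1 hst) h₁ h₂ h₃

end Prop45

/-! ## C′. Prop. 4.2, per coordinate: `min θᵢ = 0`, `max θᵢ = 1` over `specMM` (append 1)

The printed proof of Prop. 4.2 (p0009 L103–L105): "For any positive integer `n`, since `Q̃(⟨n,1,1⟩) = 1`
and `R̃(⟨n,1,1⟩) = n`, we have `min θ₁ = 0` and `max θ₁ = 1`, and similarly for `θ₂, θ₃`."  Here the
extremes are WITNESSED by the three gauge points (flattening ranks; universal spectral points by the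
tree's `gaugePoint{₁,₂,₃}_isUniversalSpectralPoint`): `ζ⁽¹⁾(⟨k,m,n⟩) = kn`, `ζ⁽²⁾(⟨k,m,n⟩) = km`,
`ζ⁽³⁾(⟨k,m,n⟩) = mn`, so on the three lines `⟨2,1,1⟩, ⟨1,2,1⟩, ⟨1,1,2⟩` each gauge point takes the
values `1` and `2` in the right places. -/

section Coordinates

/-- `ζ⁽¹⁾(⟨k,m,n⟩) = k·n` (`m ≥ 1`): the flattening rank of the matrix multiplication tensor along
its first leg (tree `flatteningRank_multiple_matMulTensor` with the factor `⟨1⟩`).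
[cite: ChristandlVranaZuiddam2023, Example 1.4] -/
theorem gaugePoint₁_matMulTensor {k m n : ℕ} (hm : 0 < m) :
    gaugePoint₁ K (matMulTensor K k m n) = (k * n : ℕ) := by
  have hG := gaugePoint₁_isUniversalSpectralPoint K
  have h := hG.map_kronecker (unitTensor K 1) (matMulTensor K k m n)
  rw [hG.map_unitTensor_one, one_mul, gaugePoint₁_eq,
    flatteningRank_multiple_matMulTensor 1 k m n hm, one_mul] at h
  exact h.symm

omit [Field K] in
/-- Swapping the first two legs of `⟨k,m,n⟩` gives `⟨k,n,m⟩` with the third index pair swapped.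
[cite: Blaser2013, Lemma 5.5] -/
theorem matMulTensor_swap₁₂_eq [CommSemiring K] (k m n : ℕ) :
    (fun b a c => matMulTensor K k m n a b c) =
      fun x y z => matMulTensor K k n m x y (Prod.swap z) := by
  funext x y z
  obtain ⟨x₁, x₂⟩ := x; obtain ⟨y₁, y₂⟩ := y; obtain ⟨z₁, z₂⟩ := z
  simp only [matMulTensor, Prod.swap_prod_mk]
  exact if_congr ⟨fun ⟨h1, h2, h3⟩ => ⟨h1.symm, h3, h2⟩, fun ⟨h1, h2, h3⟩ => ⟨h1.symm, h3, h2⟩⟩ rfl rfl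

omit [Field K] in
/-- Moving the third leg of `⟨k,m,n⟩` to the front gives `⟨n,k,m⟩` with two index pairs swapped.
[cite: Blaser2013, Lemma 5.5] -/
theorem matMulTensor_swap₃_eq [CommSemiring K] (k m n : ℕ) :
    (fun c a b => matMulTensor K k m n a b c) =
      fun z x y => matMulTensor K n k m (Prod.swap z) (Prod.swap x) y := by
  funext z x y
  obtain ⟨x₁, x₂⟩ := x; obtain ⟨y₁, y₂⟩ := y; obtain ⟨z₁, z₂⟩ := z
  simp only [matMulTensor, Prod.swap_prod_mk]
  exact if_congr ⟨fun ⟨h1, h2, h3⟩ => ⟨h3.symm, h1, h2.symm⟩, fun ⟨h1, h2, h3⟩ => ⟨h2, h3.symm, h1.symm⟩⟩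
    rfl rfl

/-- `ζ⁽²⁾(⟨k,m,n⟩) = k·m` (`n ≥ 1`). [cite: ChristandlVranaZuiddam2023, Example 1.4] -/
theorem gaugePoint₂_matMulTensor {k m n : ℕ} (hn : 0 < n) :
    gaugePoint₂ K (matMulTensor K k m n) = (k * m : ℕ) := by
  rw [gaugePoint₂_eq_gaugePoint₁_swap, matMulTensor_swap₁₂_eq, gaugePoint₁_eq,
    show (fun x y z => matMulTensor K k n m x y (Prod.swap z)) =
      fun x y z => matMulTensor K k n m ((Equiv.refl _) x) ((Equiv.refl _) y) ((Equiv.prodComm _ _) z)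
      from rfl, flatteningRank_reindex, ← gaugePoint₁_eq, gaugePoint₁_matMulTensor hn]

/-- `ζ⁽³⁾(⟨k,m,n⟩) = m·n` (`k ≥ 1`). [cite: ChristandlVranaZuiddam2023, Example 1.4] -/
theorem gaugePoint₃_matMulTensor {k m n : ℕ} (hk : 0 < k) :
    gaugePoint₃ K (matMulTensor K k m n) = (n * m : ℕ) := by
  rw [gaugePoint₃_eq_gaugePoint₁_swap, matMulTensor_swap₃_eq, gaugePoint₁_eq,
    show (fun z x y => matMulTensor K n k m (Prod.swap z) (Prod.swap x) y) =
      fun z x y => matMulTensor K n k m ((Equiv.prodComm _ _) z) ((Equiv.prodComm _ _) x)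
        ((Equiv.refl _) y) from rfl, flatteningRank_reindex, ← gaugePoint₁_eq, gaugePoint₁_matMulTensor hk]

/-- **Prop. 4.2 (proof), lower extremes: `min θᵢ = 0` over `specMM` for each `i`** — `θᵢ ≥ 0`
everywhere (`prop42_mem_Icc`) and the value `0` is attained: `θ₁(ζ⁽³⁾) = log₂ ζ⁽³⁾(⟨2,1,1⟩) = log₂ 1`,
`θ₂(ζ⁽¹⁾) = log₂ ζ⁽¹⁾(⟨1,2,1⟩) = log₂ 1`, `θ₃(ζ⁽²⁾) = log₂ ζ⁽²⁾(⟨1,1,2⟩) = log₂ 1` (printed: "since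
`Q̃(⟨n,1,1⟩) = 1` … `min θ₁ = 0` … and similarly for `θ₂, θ₃`"). [cite: AlmanLi2026, Proposition 4.2 (proof)] -/
theorem AlmanLi2026.prop42_coord_isLeast (i : Fin 3) :
    IsLeast ((fun θ : Fin 3 → ℝ => θ i) '' specMM K) 0 := by
  refine ⟨?_, ?_⟩
  · fin_cases i
    · refine ⟨specMMPoint K (gaugePoint₃ K), specMMPoint_mem_specMM (gaugePoint₃_isUniversalSpectralPoint K), ?_⟩
      show specMMPoint K (gaugePoint₃ K) 0 = 0
      rw [specMMPoint_zero, gaugePoint₃_matMulTensor (by norm_num)]; norm_num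
    · refine ⟨specMMPoint K (gaugePoint₁ K), specMMPoint_mem_specMM (gaugePoint₁_isUniversalSpectralPoint K), ?_⟩
      show specMMPoint K (gaugePoint₁ K) 1 = 0
      rw [specMMPoint_one, gaugePoint₁_matMulTensor (by norm_num)]; norm_num
    · refine ⟨specMMPoint K (gaugePoint₂ K), specMMPoint_mem_specMM (gaugePoint₂_isUniversalSpectralPoint K), ?_⟩
      show specMMPoint K (gaugePoint₂ K) 2 = 0
      rw [specMMPoint_two, gaugePoint₂_matMulTensor (by norm_num)]; norm_num
  · rintro _ ⟨θ, hθ, rfl⟩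
    exact ((AlmanLi2026.prop42 hθ).1 i).1

/-- **Prop. 4.2 (proof), upper extremes: `max θᵢ = 1` over `specMM` for each `i`** — `θᵢ ≤ 1`
everywhere and the value `1` is attained: `θ₁(ζ⁽¹⁾) = log₂ ζ⁽¹⁾(⟨2,1,1⟩) = log₂ 2`,
`θ₂(ζ⁽²⁾) = log₂ 2`, `θ₃(ζ⁽¹⁾) = log₂ 2` (printed: "since … `R̃(⟨n,1,1⟩) = n`, we have … `max θ₁ = 1`,
and similarly for `θ₂, θ₃`"). [cite: AlmanLi2026, Proposition 4.2 (proof)] -/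
theorem AlmanLi2026.prop42_coord_isGreatest (i : Fin 3) :
    IsGreatest ((fun θ : Fin 3 → ℝ => θ i) '' specMM K) 1 := by
  refine ⟨?_, ?_⟩
  · fin_cases i
    · refine ⟨specMMPoint K (gaugePoint₁ K), specMMPoint_mem_specMM (gaugePoint₁_isUniversalSpectralPoint K), ?_⟩
      show specMMPoint K (gaugePoint₁ K) 0 = 1
      rw [specMMPoint_zero, gaugePoint₁_matMulTensor (by norm_num)]
      norm_num [Real.logb_self_eq_one]
    · refine ⟨specMMPoint K (gaugePoint₂ K), specMMPoint_mem_specMM (gaugePoint₂_isUniversalSpectralPoint K), ?_⟩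
      show specMMPoint K (gaugePoint₂ K) 1 = 1
      rw [specMMPoint_one, gaugePoint₂_matMulTensor (by norm_num)]
      norm_num [Real.logb_self_eq_one]
    · refine ⟨specMMPoint K (gaugePoint₁ K), specMMPoint_mem_specMM (gaugePoint₁_isUniversalSpectralPoint K), ?_⟩
      show specMMPoint K (gaugePoint₁ K) 2 = 1
      rw [specMMPoint_two, gaugePoint₁_matMulTensor (by norm_num)]
      norm_num [Real.logb_self_eq_one]
  · rintro _ ⟨θ, hθ, rfl⟩
    exact ((AlmanLi2026.prop42 hθ).1 i).2

end Coordinates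

end Spectrum

end Literature.Computability.AlgebraicComplexity

end
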